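import Literature.NumberTheory.EllipticCurves.PAdicMeasureConvolutionProofs
import HarnessLib

/-!
# The smoothed `χ₋₄`-weighted Eisenstein–Dedekind measure at `2` and its transform
# `(∑_t κ_t χ₋₄(t)(1+T)^{−f_t}) · G(T^ι)·G(T)` (Stevens 1982 §5.4 at `p = 2`)

Topic `Literature/NumberTheory/EllipticCurves`; namespace `Literature.NumberTheory.EllipticCurves`.
Sequel to `PAdicMeasureConvolutionProofs` (the unit convolution `⋆`, `[c]_*`/`[c]^*`, Stevens'
smoothing identity `klTwoConv = Sm_5^5((χ₋₄E₁)ˇ ⋆ χ₋₄E₁)`, the transform product theorem and the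
Dedekind-sum bridge). Everything here is PROVED (no named facts).

* §1 LINEARITY of the transform for bounded distributions (`distributionTransform_add/_smul/
  _finset_sum_smul`; Lang Ch. 4 §1: `μ ↦ P_μ` is `𝔬`-linear — here for the coefficientwise-limit
  definition `distributionTransform`, via convergence of each summand's Riemann sums).
* §2 Stevens' smoothing operator **`stevensSmoothing r μ = μ − r[r]_*μ − r[r]^*μ + r²μ`**
  (`Sm_r^r = (1 − rσ(r))(1 − rσ(r)⁻¹)`, [Stevens1982, §5.4, PDF p. 73]), linear and commuting with all
  `[t]_*`, `[t]^*`; `klTwoConv = Sm_5^5(klTwoDedekindConv)` (`klTwoConv_eq_stevensSmoothing`).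
* §3 For a LEVEL STRUCTURE `(T, κ)` — a finite set `T` of odd levels and coefficients `κ : ℕ → ℚ`
  (for the weight-2 Eisenstein series `E_β` of odd level `N` attached to a `U`-eigen sign vector `β`
  these are `T = {t ∣ N}` and `κ_t = ∏_{ℓ∣t}(−β_ℓ/ℓ)`; NOTHING about them is assumed here) — the
  `χ₋₄`-weighted Eisenstein–Dedekind distribution
  **`eisensteinDedekindTwo T κ = ∑_{t∈T} κ_t χ₋₄(t)·[t]^* klTwoDedekindConv`**, an (unbounded)
  distribution (`eisensteinDedekindTwo_distribution`, with `klTwoDistribution_distribution`,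
  `klTwoDedekindConv_distribution`) whose level-`n` values are, for `n ≥ 2` and odd `a`,
  **`χ₋₄(a) · ∑_{t∈T} κ_t (s(at, 2ⁿ) − s(at, 2ⁿ⁻¹))`** (`eisensteinDedekindTwo_apply_of_two_le`, tree
  `Literature.NumberTheory.ModularForms.dedekindSum`) — i.e. `−1/12 ×` the `χ₋₄`-weighted,
  `α = 1`-stabilised Dedekind part `Φ(a/2ⁿ) − Φ(a/2ⁿ⁻¹)` of the cusp values of the period
  homomorphism `φ_β = −∑_{t∣N, t>1} κ_t Ψ_t` (Stevens' `g_E(x) = s_E(N₂x)`, §5.4); its smoothing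
  **`smoothedEisensteinDedekindTwo T κ = Sm_5^5(E_{T,κ}) = ∑_t κ_tχ₋₄(t)·[t]^* klTwoConv`**
  (`stevensSmoothing_eisensteinDedekindTwo`), a bounded measure (`_distribution`, `norm_…_le`);
  and ITS TRANSFORM
  **`L(Sm_5^5 E_{T,κ}) = (∑_{t∈T} κ_t χ₋₄(t) (1+T)^{−f_t}) · G(T^ι)·G(T)`**
  (`distributionTransform_smoothedEisensteinDedekindTwo`; `t ≡ η_t γ^{f_t}` Teichmüller–exponent data
  as produced by `exists_teichmuller_exponent_natCast`; `G = klTwoNumerator`, `G(T^ι) = klTwoNumeratorInv`)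
  — Stevens' factorisation [Stevens1982, §5.4, PDF p. 74] of the `2`-adic `L`-function of a weight-2
  Eisenstein series into two Kubota–Leopoldt halves and a level factor, for the smoothed Dedekind
  part, sorry-free.  (For `T` = the divisors of a squarefree `N` and multiplicative data the level
  factor is the Euler-type product `∏_{ℓ∣N}(1 − β_ℓχ₋₄(ℓ)ℓ⁻¹(1+T)^{−f_ℓ})` by `Finset.prod_one_add`;
  that bookkeeping is left to the user.)
* §4 EVENNESS (appended): `klTwoDistribution_neg`, `klTwoDedekindConv_neg`, `eisensteinDedekindTwo_neg`,
  `smoothedEisensteinDedekindTwo_neg` — all these set functions are even under `a ↦ −a` (needed to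
  pass between a measure on `ℤ₂^× = {±1}·(1 + 4ℤ₂)` and its `η = +1` half).

## References

* G. Stevens, *Arithmetic on Modular Curves*, Progress in Math. 20, Birkhäuser 1982 — §2.5, §5.4
  (PDF pp. 72–74, Prop. 5.4.1 and the factorisation of `L_p(E, χ, s)`). Held text
  `book:stevensnd-arithmetic-modular-curves`. [Stevens1982]
* S. Lang, *Cyclotomic Fields I and II*, GTM 121, Springer 1990 — Ch. 4 §1 (PDF p. 78: the Iwasawa
  map is `𝔬`-linear), Ch. 4 §2 (PDF pp. 80–82: operations `[c]_*`, `[c]^*`), Ch. 12 §1 (PDF p. 187).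
  [LangCyclotomic1990]
* B. Mazur, J. Tate, J. Teitelbaum, *On `p`-adic analogues of the conjectures of Birch and
  Swinnerton-Dyer*, Invent. Math. 84 (1986), §I.13. [MazurTateTeitelbaum1986Invent]
* H. Rademacher, E. Grosswald, *Dedekind Sums*, Carus Math. Monographs 16, MAA 1972, Ch. 1 eq. (1)–(2).
  [RademacherGrosswald1972]
-/

noncomputable section

open scoped Classical

open Filter Topology

namespace Literature.NumberTheory.EllipticCurves

variable {p : ℕ} [Fact p.Prime]

/-! ## §1 Linearity of the transform -/

section Linearity

variable {μ ν : (n : ℕ) → ZMod (p ^ n) → ℚ_[p]}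

/-- The Riemann sums are additive in the set function (finite sums). [cite: MazurTateTeitelbaum1986Invent, §I.13 (unfolding)] -/
theorem distributionRiemannSum_add (k n : ℕ) :
    distributionRiemannSum (μ + ν) k n = distributionRiemannSum μ k n + distributionRiemannSum ν k n := by
  haveI := neZero_torsionOrder p
  haveI := Fintype.ofFinite (rootsOfUnity (torsionOrder p) ℤ_[p])
  simp only [distributionRiemannSum, finsum_eq_sum_of_fintype, Pi.add_apply, add_mul,
    Finset.sum_add_distrib]

/-- The Riemann sums are homogeneous in the set function. [cite: MazurTateTeitelbaum1986Invent, §I.13 (unfolding)] -/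
theorem distributionRiemannSum_smul (c : ℚ_[p]) (k n : ℕ) :
    distributionRiemannSum (c • μ) k n = c * distributionRiemannSum μ k n := by
  haveI := neZero_torsionOrder p
  haveI := Fintype.ofFinite (rootsOfUnity (torsionOrder p) ℤ_[p])
  simp only [distributionRiemannSum, finsum_eq_sum_of_fintype, Pi.smul_apply, smul_eq_mul,
    Finset.mul_sum, mul_assoc]

/-- The Riemann sums of a finite linear combination. [cite: MazurTateTeitelbaum1986Invent, §I.13 (unfolding)] -/
theorem distributionRiemannSum_finset_sum_smul {ι : Type*} (s : Finset ι) (c : ι → ℚ_[p])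
    (ρ : ι → (n : ℕ) → ZMod (p ^ n) → ℚ_[p]) (k n : ℕ) :
    distributionRiemannSum (∑ i ∈ s, c i • ρ i) k n = ∑ i ∈ s, c i * distributionRiemannSum (ρ i) k n := by
  induction s using Finset.induction_on with
  | empty =>
    haveI := neZero_torsionOrder p
    haveI := Fintype.ofFinite (rootsOfUnity (torsionOrder p) ℤ_[p])
    simp [distributionRiemannSum, finsum_eq_sum_of_fintype]
  | insert i s hi ih =>
    rw [Finset.sum_insert hi, Finset.sum_insert hi, distributionRiemannSum_add,
      distributionRiemannSum_smul, ih]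

/-- **The transform of a finite linear combination of bounded distributions is the linear combination
of the transforms** (the Iwasawa map `μ ↦ P_μ` is `𝔬`-linear, Lang Ch. 4 §1; here for the
coefficientwise-limit definition, using convergence of each summand's Riemann sums).
[cite: LangCyclotomic1990, Ch. 4 §1 (P is σ-linear, PDF p. 78)] [cite: MazurTateTeitelbaum1986Invent, §I.13] -/
theorem distributionTransform_finset_sum_smul {ι : Type*} (s : Finset ι) (c : ι → ℚ_[p])
    (ρ : ι → (n : ℕ) → ZMod (p ^ n) → ℚ_[p])
    (hρ : ∀ i ∈ s, ∀ (n : ℕ) (a : ZMod (p ^ n)),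
      ∑ b ∈ Finset.univ.filter (fun b : ZMod (p ^ (n + 1)) ↦
        ZMod.castHom (pow_dvd_pow p n.le_succ) (ZMod (p ^ n)) b = a), ρ i (n + 1) b = ρ i n a)
    (hC : ∀ i ∈ s, ∃ C : ℝ, ∀ (n : ℕ) (a : ZMod (p ^ n)), ‖ρ i n a‖ ≤ C) :
    distributionTransform (∑ i ∈ s, c i • ρ i) =
      ∑ i ∈ s, PowerSeries.C (c i) * distributionTransform (ρ i) := by
  ext k
  rw [coeff_distributionTransform, map_sum]
  simp only [PowerSeries.coeff_C_mul, coeff_distributionTransform]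
  refine Tendsto.limUnder_eq ?_
  have h : (distributionRiemannSum (∑ i ∈ s, c i • ρ i) k) =
      fun n ↦ ∑ i ∈ s, c i * distributionRiemannSum (ρ i) k n :=
    funext fun n ↦ distributionRiemannSum_finset_sum_smul s c ρ k n
  rw [h]
  refine tendsto_finsetSum _ fun i hi ↦ ?_
  obtain ⟨C, hCi⟩ := hC i hi
  have ht := tendsto_distributionRiemannSum (hρ i hi) hCi k
  rw [coeff_distributionTransform] at ht
  exact ht.const_mul _

/-- **Additivity of the transform** for bounded distributions. [cite: LangCyclotomic1990, Ch. 4 §1 (P is σ-linear, PDF p. 78)] -/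
theorem distributionTransform_add
    (hμ : ∀ (n : ℕ) (a : ZMod (p ^ n)),
      ∑ b ∈ Finset.univ.filter (fun b : ZMod (p ^ (n + 1)) ↦
        ZMod.castHom (pow_dvd_pow p n.le_succ) (ZMod (p ^ n)) b = a), μ (n + 1) b = μ n a)
    {C : ℝ} (hC : ∀ (n : ℕ) (a : ZMod (p ^ n)), ‖μ n a‖ ≤ C)
    (hν : ∀ (n : ℕ) (a : ZMod (p ^ n)),
      ∑ b ∈ Finset.univ.filter (fun b : ZMod (p ^ (n + 1)) ↦
        ZMod.castHom (pow_dvd_pow p n.le_succ) (ZMod (p ^ n)) b = a), ν (n + 1) b = ν n a)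
    {D : ℝ} (hD : ∀ (n : ℕ) (a : ZMod (p ^ n)), ‖ν n a‖ ≤ D) :
    distributionTransform (μ + ν) = distributionTransform μ + distributionTransform ν := by
  ext k
  rw [map_add, coeff_distributionTransform, coeff_distributionTransform, coeff_distributionTransform]
  refine Tendsto.limUnder_eq ?_
  have h : distributionRiemannSum (μ + ν) k =
      fun n ↦ distributionRiemannSum μ k n + distributionRiemannSum ν k n :=
    funext fun n ↦ distributionRiemannSum_add k n
  rw [h]
  have h1 := tendsto_distributionRiemannSum hμ hC k
  have h2 := tendsto_distributionRiemannSum hν hD k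
  rw [coeff_distributionTransform] at h1 h2
  exact h1.add h2

/-- **Homogeneity of the transform** for a bounded distribution. [cite: LangCyclotomic1990, Ch. 4 §1 (P is σ-linear, PDF p. 78)] -/
theorem distributionTransform_smul (c : ℚ_[p])
    (hμ : ∀ (n : ℕ) (a : ZMod (p ^ n)),
      ∑ b ∈ Finset.univ.filter (fun b : ZMod (p ^ (n + 1)) ↦
        ZMod.castHom (pow_dvd_pow p n.le_succ) (ZMod (p ^ n)) b = a), μ (n + 1) b = μ n a)
    {C : ℝ} (hC : ∀ (n : ℕ) (a : ZMod (p ^ n)), ‖μ n a‖ ≤ C) :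
    distributionTransform (c • μ) = PowerSeries.C c * distributionTransform μ := by
  have h := distributionTransform_finset_sum_smul {(0 : ℕ)} (fun _ ↦ c) (fun _ ↦ μ)
    (fun _ _ ↦ hμ) (fun _ _ ↦ ⟨C, hC⟩)
  simpa using h

end Linearity

/-! ## §2 Stevens' smoothing operator `Sm_r^r = (1 − r[r]_*)(1 − r[r]^*)` -/

section Smoothing

variable {μ μ₁ μ₂ : (n : ℕ) → ZMod (p ^ n) → ℚ_[p]}

/-- **Stevens' two-sided smoothing** `Sm_r^r μ = (1 − rσ(r))(1 − rσ(r)⁻¹)μ = μ − r[r]_*μ − r[r]^*μ + r²μ`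
(the two factors commute; `[r]_*[r]^* = 1` for `r` prime to `p`).
[cite: Stevens1982, §5.4 (PDF p. 73, Sm_{r₁}^{r₂} = (1 − r₁σ(r₁))(1 − r₂σ(r₂)⁻¹))] -/
def stevensSmoothing (r : ℕ) (μ : (n : ℕ) → ZMod (p ^ n) → ℚ_[p]) : (n : ℕ) → ZMod (p ^ n) → ℚ_[p] :=
  μ - (r : ℚ_[p]) • dilate r μ - (r : ℚ_[p]) • codilate r μ + ((r : ℚ_[p]) ^ 2) • μ

/-- Unfolding of `stevensSmoothing`. [cite: Stevens1982, §5.4 (PDF p. 73) (unfolding)] -/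
theorem stevensSmoothing_def (r : ℕ) (μ : (n : ℕ) → ZMod (p ^ n) → ℚ_[p]) :
    stevensSmoothing r μ =
      μ - (r : ℚ_[p]) • dilate r μ - (r : ℚ_[p]) • codilate r μ + ((r : ℚ_[p]) ^ 2) • μ :=
  rfl

/-- `Sm_r^r` is additive. [cite: Stevens1982, §5.4 (PDF p. 73)] -/
theorem stevensSmoothing_add (r : ℕ) :
    stevensSmoothing r (μ₁ + μ₂) = stevensSmoothing r μ₁ + stevensSmoothing r μ₂ := by
  simp only [stevensSmoothing, dilate_add, codilate_add, smul_add]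
  abel

/-- `Sm_r^r` is homogeneous. [cite: Stevens1982, §5.4 (PDF p. 73)] -/
theorem stevensSmoothing_smul (r : ℕ) (c : ℚ_[p]) :
    stevensSmoothing r (c • μ) = c • stevensSmoothing r μ := by
  simp only [stevensSmoothing, dilate_smul, codilate_smul, smul_sub, smul_add, smul_smul, mul_comm c]

/-- `Sm_r^r` on a finite linear combination. [cite: Stevens1982, §5.4 (PDF p. 73)] -/
theorem stevensSmoothing_finset_sum_smul (r : ℕ) {ι : Type*} (s : Finset ι) (c : ι → ℚ_[p])
    (ρ : ι → (n : ℕ) → ZMod (p ^ n) → ℚ_[p]) :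
    stevensSmoothing r (∑ i ∈ s, c i • ρ i) = ∑ i ∈ s, c i • stevensSmoothing r (ρ i) := by
  induction s using Finset.induction_on with
  | empty =>
    simp only [Finset.sum_empty]
    funext n a
    simp [stevensSmoothing, dilate, codilate]
  | insert i s hi ih =>
    rw [Finset.sum_insert hi, Finset.sum_insert hi, stevensSmoothing_add, stevensSmoothing_smul, ih]

/-- `[r]_*` and `[t]^*` commute. [cite: LangCyclotomic1990, Ch. 4 §2 (PDF pp. 80–82)] -/
theorem dilate_codilate_comm (r t : ℕ) : dilate r (codilate t μ) = codilate t (dilate r μ) := by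
  funext n a
  simp only [dilate, codilate, mul_right_comm]

/-- `[r]^*` and `[t]^*` commute. [cite: LangCyclotomic1990, Ch. 4 §2 (PDF pp. 80–82)] -/
theorem codilate_codilate_comm (r t : ℕ) : codilate r (codilate t μ) = codilate t (codilate r μ) := by
  funext n a
  simp only [codilate, mul_right_comm]

/-- `[r]_*` and `[t]_*` commute. [cite: LangCyclotomic1990, Ch. 4 §2 (PDF pp. 80–82)] -/
theorem dilate_dilate_comm (r t : ℕ) : dilate r (dilate t μ) = dilate t (dilate r μ) := by
  funext n a
  simp only [dilate, mul_right_comm]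

/-- **`Sm_r^r` commutes with every pull-back `[t]^*`.** [cite: Stevens1982, §5.4 (PDF p. 73)] [cite: LangCyclotomic1990, Ch. 4 §2 (PDF pp. 80–82)] -/
theorem stevensSmoothing_codilate (r t : ℕ) :
    stevensSmoothing r (codilate t μ) = codilate t (stevensSmoothing r μ) := by
  simp only [stevensSmoothing, codilate_sub, codilate_add, codilate_smul, dilate_codilate_comm,
    codilate_codilate_comm r t]

/-- **`Sm_r^r` commutes with every push-forward `[t]_*`.** [cite: Stevens1982, §5.4 (PDF p. 73)] [cite: LangCyclotomic1990, Ch. 4 §2 (PDF pp. 80–82)] -/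
theorem stevensSmoothing_dilate (r t : ℕ) :
    stevensSmoothing r (dilate t μ) = dilate t (stevensSmoothing r μ) := by
  simp only [stevensSmoothing, dilate_sub, dilate_add, dilate_smul, ← dilate_codilate_comm,
    dilate_dilate_comm r t]

/-- **`klTwoConv = Sm_5^5((χ₋₄E₁)ˇ ⋆ χ₋₄E₁)`** (restatement of `klTwoConv_eq_smoothing` with the named
operator). [cite: Stevens1982, §5.4 Prop. 5.4.1 (PDF p. 73)] -/
theorem klTwoConv_eq_stevensSmoothing : klTwoConv = stevensSmoothing 5 klTwoDedekindConv := by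
  rw [klTwoConv_eq_smoothing, stevensSmoothing]
  norm_num

end Smoothing

/-! ## §3 The `χ₋₄`-weighted Eisenstein–Dedekind distribution of a level structure `(T, κ)` at `2` -/

section EisensteinDedekindTwo

/-- **The `χ₋₄`-weighted Eisenstein–Dedekind distribution at `2` of a level structure** `(T, κ)`
(`T` a finite set of odd levels `t`, `κ : ℕ → ℚ` coefficients — for a weight-2 Eisenstein series
`∑_{t} c_t E₂(tz)` of level `N` these are the `t ∣ N` and the period-homomorphism coefficients
`κ_t`, e.g. `κ_t = ∏_{ℓ∣t}(−β_ℓ/ℓ)` for a `U`-eigen sign vector `β`; nothing about them is assumed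
here): `E_{T,κ} := ∑_{t∈T} κ_t χ₋₄(t) · [t]^*((χ₋₄E₁)ˇ ⋆ χ₋₄E₁)`, whose value on `a + 2ⁿℤ₂` (`n ≥ 2`,
`a` odd) is `χ₋₄(a) · ∑_{t∈T} κ_t (s(at, 2ⁿ) − s(at, 2ⁿ⁻¹))` (`eisensteinDedekindTwo_apply_of_two_le`)
— Stevens' Dedekind-symbol distribution `g_E(x) = s_E(N₂x)` (§5.4) at `p = 2`, Dedekind part,
`χ₋₄`-weighted and `α = 1`-stabilised. A distribution, not a measure.
[cite: Stevens1982, §2.5 and §5.4 (PDF pp. 72–73, g_E and μ_E)] -/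
def eisensteinDedekindTwo (T : Finset ℕ) (κ : ℕ → ℚ) : (n : ℕ) → ZMod (2 ^ n) → ℚ_[2] :=
  ∑ t ∈ T, ((κ t : ℚ_[2]) * ((chiMinusFour 2 t : ℤ_[2]) : ℚ_[2])) • codilate t klTwoDedekindConv

/-- **Its Stevens smoothing** `Sm_5^5 E_{T,κ} = ∑_{t∈T} κ_tχ₋₄(t)·[t]^*(klTwoConv)` — a genuine measure
(each summand is the pull-back of the measure `klTwoConv`).
[cite: Stevens1982, §5.4 Prop. 5.4.1 (PDF p. 73)] -/
def smoothedEisensteinDedekindTwo (T : Finset ℕ) (κ : ℕ → ℚ) : (n : ℕ) → ZMod (2 ^ n) → ℚ_[2] :=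
  ∑ t ∈ T, ((κ t : ℚ_[2]) * ((chiMinusFour 2 t : ℤ_[2]) : ℚ_[2])) • codilate t klTwoConv

/-- **`Sm_5^5 E_{T,κ}` is the smoothed Eisenstein–Dedekind measure** (`Sm` is linear and commutes with
the `[t]^*`; `Sm_5^5 D = klTwoConv`). [cite: Stevens1982, §5.4 Prop. 5.4.1 (PDF p. 73)] -/
theorem stevensSmoothing_eisensteinDedekindTwo (T : Finset ℕ) (κ : ℕ → ℚ) :
    stevensSmoothing 5 (eisensteinDedekindTwo T κ) = smoothedEisensteinDedekindTwo T κ := by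
  rw [eisensteinDedekindTwo, stevensSmoothing_finset_sum_smul, smoothedEisensteinDedekindTwo]
  refine Finset.sum_congr rfl fun t _ ↦ ?_
  rw [stevensSmoothing_codilate, ← klTwoConv_eq_stevensSmoothing]

/-- `χ₄(u²) = 1` for a unit `u` of `ℤ/4`. [folklore] -/
private theorem χ₄_sq_of_unit (u : (ZMod 4)ˣ) : ZMod.χ₄ ((u : ZMod 4) * (u : ZMod 4)) = 1 := by
  revert u
  decide

/-- An odd natural number is prime to `2`. [folklore] -/
private theorem two_coprime_of_odd {t : ℕ} (ht : Odd t) : (2 : ℕ).Coprime t :=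
  (Nat.coprime_two_left.mpr ht)

/-- **`χ₋₄E₁` vanishes on the even classes of positive level** (`χ₋₄(b) = 0` for even `b`).
[cite: LangCyclotomic1990, Ch. 4 §3 (χE_{1,c} on Z*, PDF p. 84)] -/
theorem klTwoDistribution_eq_zero_of_not_isUnit (n : ℕ) (hn : 1 ≤ n) (a : ZMod (2 ^ n))
    (ha : ¬ IsUnit a) : klTwoDistribution n a = 0 := by
  haveI : NeZero (2 ^ n) := ⟨pow_ne_zero _ two_ne_zero⟩
  haveI : NeZero (4 * 2 ^ n) := ⟨mul_ne_zero four_ne_zero (pow_ne_zero _ two_ne_zero)⟩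
  unfold klTwoDistribution bernoulliDistribution
  refine Finset.sum_eq_zero fun b hb ↦ ?_
  simp only [Finset.mem_filter, Finset.mem_univ, true_and] at hb
  have hav : a.val = b.val % 2 ^ n := by
    rw [← hb, ZMod.castHom_apply, ZMod.cast_eq_val, ZMod.val_natCast]
  have ha2 : 2 ∣ a.val := by
    by_contra h2
    apply ha
    rw [← ZMod.natCast_zmod_val a]
    exact (ZMod.isUnit_natCast_iff_not_dvd_pow Nat.prime_two hn).mpr h2
  have hb2 : 2 ∣ b.val := (Nat.dvd_mod_iff (dvd_pow_self 2 (by omega))).mp (hav ▸ ha2)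
  rw [chiMinusFour_eq_zero_of_two_dvd (p := 2) hb2, PadicInt.coe_zero, zero_mul]

/-- **`χ₋₄E₁` satisfies the distribution relation.** [cite: LangCyclotomic1990, Ch. 2 §2 (E_k^{(N)} is a distribution, PDF pp. 34–36)] -/
theorem klTwoDistribution_distribution (n : ℕ) (a : ZMod (2 ^ n)) :
    ∑ b ∈ Finset.univ.filter (fun b : ZMod (2 ^ (n + 1)) ↦
        ZMod.castHom (pow_dvd_pow 2 n.le_succ) (ZMod (2 ^ n)) b = a),
      klTwoDistribution (n + 1) b = klTwoDistribution n a := by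
  unfold klTwoDistribution
  exact bernoulliDistribution_distribution (p := 2) (N := 4) (θ := chiMinusFour 2) (k := 1)
    (chiMinusFour_add_four (p := 2)) le_rfl n a

/-- **`(χ₋₄E₁)ˇ ⋆ χ₋₄E₁` satisfies the distribution relation** (a distribution on `ℤ₂^×`, unbounded).
[cite: Stevens1982, §5.4 (PDF p. 73, μ_E is a distribution, not a measure)] [cite: LangCyclotomic1990, Ch. 12 §1 (PDF p. 187)] -/
theorem klTwoDedekindConv_distribution (n : ℕ) (a : ZMod (2 ^ n)) :
    ∑ b ∈ Finset.univ.filter (fun b : ZMod (2 ^ (n + 1)) ↦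
        ZMod.castHom (pow_dvd_pow 2 n.le_succ) (ZMod (2 ^ n)) b = a),
      klTwoDedekindConv (n + 1) b = klTwoDedekindConv n a := by
  unfold klTwoDedekindConv
  exact unitsConv_distribution
    (invUnitsDist_distribution klTwoDistribution_distribution klTwoDistribution_eq_zero_of_not_isUnit)
    (fun m _ b hb ↦ by rw [invUnitsDist, dif_neg hb]) klTwoDistribution_distribution n a

/-- **`E_{T,κ}` satisfies the distribution relation** (all `t ∈ T` odd).
[cite: Stevens1982, §5.4 (PDF p. 73)] -/
theorem eisensteinDedekindTwo_distribution (T : Finset ℕ) (κ : ℕ → ℚ) (hT : ∀ t ∈ T, Odd t)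
    (n : ℕ) (a : ZMod (2 ^ n)) :
    ∑ b ∈ Finset.univ.filter (fun b : ZMod (2 ^ (n + 1)) ↦
        ZMod.castHom (pow_dvd_pow 2 n.le_succ) (ZMod (2 ^ n)) b = a),
      eisensteinDedekindTwo T κ (n + 1) b = eisensteinDedekindTwo T κ n a := by
  simp only [eisensteinDedekindTwo, Finset.sum_apply, Pi.smul_apply, smul_eq_mul]
  rw [Finset.sum_comm]
  refine Finset.sum_congr rfl fun t ht ↦ ?_
  rw [← Finset.mul_sum, codilate_distribution (two_coprime_of_odd (hT t ht)) klTwoDedekindConv_distribution n a]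

/-- **The smoothed Eisenstein–Dedekind measure satisfies the distribution relation** (all `t ∈ T` odd).
[cite: Stevens1982, §5.4 Prop. 5.4.1 (PDF p. 73)] -/
theorem smoothedEisensteinDedekindTwo_distribution (T : Finset ℕ) (κ : ℕ → ℚ) (hT : ∀ t ∈ T, Odd t)
    (n : ℕ) (a : ZMod (2 ^ n)) :
    ∑ b ∈ Finset.univ.filter (fun b : ZMod (2 ^ (n + 1)) ↦
        ZMod.castHom (pow_dvd_pow 2 n.le_succ) (ZMod (2 ^ n)) b = a),
      smoothedEisensteinDedekindTwo T κ (n + 1) b = smoothedEisensteinDedekindTwo T κ n a := by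
  simp only [smoothedEisensteinDedekindTwo, Finset.sum_apply, Pi.smul_apply, smul_eq_mul]
  rw [Finset.sum_comm]
  refine Finset.sum_congr rfl fun t ht ↦ ?_
  rw [← Finset.mul_sum, codilate_distribution (two_coprime_of_odd (hT t ht)) klTwoConv_distribution n a]

/-- **The smoothed Eisenstein–Dedekind measure is bounded** by `max_t ‖κ_t‖` (each `[t]^* klTwoConv` is
bounded by `1`, `‖χ₋₄(t)‖ ≤ 1`). [cite: Stevens1982, §5.4 Prop. 5.4.1 (PDF p. 73)] -/
theorem norm_smoothedEisensteinDedekindTwo_le (T : Finset ℕ) (κ : ℕ → ℚ) (n : ℕ) (a : ZMod (2 ^ n)) :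
    ‖smoothedEisensteinDedekindTwo T κ n a‖ ≤ ∑ t ∈ T, ‖(κ t : ℚ_[2])‖ := by
  simp only [smoothedEisensteinDedekindTwo, Finset.sum_apply, Pi.smul_apply, smul_eq_mul]
  refine (norm_sum_le _ _).trans (Finset.sum_le_sum fun t _ ↦ ?_)
  rw [norm_mul, norm_mul]
  have h1 : ‖((chiMinusFour 2 t : ℤ_[2]) : ℚ_[2])‖ ≤ 1 := PadicInt.norm_le_one _
  have h2 : ‖codilate t klTwoConv n a‖ ≤ 1 := norm_codilate_le t norm_klTwoConv_le_one n a
  calc ‖(κ t : ℚ_[2])‖ * ‖((chiMinusFour 2 t : ℤ_[2]) : ℚ_[2])‖ * ‖codilate t klTwoConv n a‖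
      ≤ ‖(κ t : ℚ_[2])‖ * 1 * 1 := by gcongr
    _ = ‖(κ t : ℚ_[2])‖ := by ring

/-- **Values of `E_{T,κ}` in Dedekind-sum shape**: for `n ≥ 2`, `a` odd and all `t ∈ T` odd,
`E_{T,κ}(a + 2ⁿℤ₂) = χ₋₄(a) · ∑_{t∈T} κ_t · (s(a·t, 2ⁿ) − s(a·t, 2ⁿ⁻¹))` (`χ₋₄(t)² = 1`).
[cite: Stevens1982, §2.5 and §5.4 (PDF pp. 72–73)] [cite: RademacherGrosswald1972, Ch. 1 eq. (1)] -/
theorem eisensteinDedekindTwo_apply_of_two_le (T : Finset ℕ) (κ : ℕ → ℚ) (hT : ∀ t ∈ T, Odd t)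
    {n : ℕ} (hn : 2 ≤ n) (a : (ZMod (2 ^ n))ˣ) :
    eisensteinDedekindTwo T κ n (a : ZMod (2 ^ n)) =
      ((chiMinusFour 2 (a : ZMod (2 ^ n)).val : ℤ_[2]) : ℚ_[2]) *
        ∑ t ∈ T, (κ t : ℚ_[2]) *
          (((Literature.NumberTheory.ModularForms.dedekindSum ((a : ZMod (2 ^ n)).val * t : ℤ) (2 ^ n) -
              Literature.NumberTheory.ModularForms.dedekindSum ((a : ZMod (2 ^ n)).val * t : ℤ) (2 ^ (n - 1)) :
              ℚ)) : ℚ_[2]) := by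
  haveI : NeZero (2 ^ n) := ⟨pow_ne_zero _ two_ne_zero⟩
  have h4 : 4 ∣ 2 ^ n := by
    obtain ⟨m, rfl⟩ := Nat.exists_eq_add_of_le hn
    exact ⟨2 ^ m, by ring⟩
  simp only [eisensteinDedekindTwo, Finset.sum_apply, Pi.smul_apply, smul_eq_mul, Finset.mul_sum]
  refine Finset.sum_congr rfl fun t ht ↦ ?_
  -- `a·t` is a unit modulo `2ⁿ`
  set u : (ZMod (2 ^ n))ˣ := ZMod.unitOfCoprime t (Nat.Coprime.pow_right n (two_coprime_of_odd (hT t ht)).symm)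
    with hu
  have huval : (u : ZMod (2 ^ n)) = (t : ZMod (2 ^ n)) := rfl
  have hat : (a : ZMod (2 ^ n)) * (t : ZMod (2 ^ n)) = ((a * u : (ZMod (2 ^ n))ˣ) : ZMod (2 ^ n)) := by
    rw [Units.val_mul, huval]
  rw [codilate, hat, klTwoDedekindConv_eq_dedekindSum hn (a * u)]
  -- the Dedekind sums: `(a u).val ≡ a.val * t` modulo `2ⁿ` and modulo `2ⁿ⁻¹`
  have hval : (((a * u : (ZMod (2 ^ n))ˣ) : ZMod (2 ^ n)).val : ℤ) % (2 ^ n : ℕ) =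
      ((a : ZMod (2 ^ n)).val * t : ℤ) % (2 ^ n : ℕ) := by
    rw [Units.val_mul, huval, ZMod.val_mul, ZMod.val_natCast]
    push_cast
    rw [Int.emod_emod_of_dvd _ (dvd_refl _), Int.mul_emod, Int.emod_emod_of_dvd _ (dvd_refl _),
      ← Int.mul_emod]
  have hs1 : Literature.NumberTheory.ModularForms.dedekindSum
      (((a * u : (ZMod (2 ^ n))ˣ) : ZMod (2 ^ n)).val : ℤ) (2 ^ n) =
      Literature.NumberTheory.ModularForms.dedekindSum ((a : ZMod (2 ^ n)).val * t : ℤ) (2 ^ n) :=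
    Literature.NumberTheory.ModularForms.dedekindSum_congr_of_emod_eq (by exact_mod_cast hval)
  have hdvd : ((2 ^ (n - 1) : ℕ) : ℤ) ∣ ((2 ^ n : ℕ) : ℤ) := by
    obtain ⟨m, rfl⟩ : ∃ m, n = m + 1 := ⟨n - 1, by omega⟩
    rw [Nat.add_sub_cancel, pow_succ]
    push_cast
    exact dvd_mul_right _ _
  have hval' : (((a * u : (ZMod (2 ^ n))ˣ) : ZMod (2 ^ n)).val : ℤ) % (2 ^ (n - 1) : ℕ) =
      ((a : ZMod (2 ^ n)).val * t : ℤ) % (2 ^ (n - 1) : ℕ) := by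
    rw [← Int.emod_emod_of_dvd _ hdvd, hval, Int.emod_emod_of_dvd _ hdvd]
  have hs2 : Literature.NumberTheory.ModularForms.dedekindSum
      (((a * u : (ZMod (2 ^ n))ˣ) : ZMod (2 ^ n)).val : ℤ) (2 ^ (n - 1)) =
      Literature.NumberTheory.ModularForms.dedekindSum ((a : ZMod (2 ^ n)).val * t : ℤ) (2 ^ (n - 1)) :=
    Literature.NumberTheory.ModularForms.dedekindSum_congr_of_emod_eq (by exact_mod_cast hval')
  rw [hs1, hs2]
  -- the characters: `χ₋₄((a t).val) χ₋₄(t) = χ₋₄(a.val)`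
  have hχ : ((chiMinusFour 2 t : ℤ_[2])) * chiMinusFour 2 (((a * u : (ZMod (2 ^ n))ˣ) : ZMod (2 ^ n))).val =
      chiMinusFour 2 (a : ZMod (2 ^ n)).val := by
    rw [chiMinusFour_val_eq_χ₄_castHom h4, chiMinusFour_val_eq_χ₄_castHom h4, Units.val_mul, huval,
      map_mul, map_natCast]
    have ht4 : chiMinusFour 2 t = ((ZMod.χ₄ (t : ZMod 4) : ℤ) : ℤ_[2]) := rfl
    rw [ht4, ← Int.cast_mul, ← map_mul ZMod.χ₄, ← mul_assoc, mul_comm (t : ZMod 4) (ZMod.castHom h4 (ZMod 4) _),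
      mul_assoc, map_mul ZMod.χ₄]
    have htu : IsUnit (t : ZMod 4) := by
      rw [ZMod.isUnit_iff_coprime]
      exact Nat.Coprime.symm ((Nat.coprime_two_left.mpr (hT t ht)).pow_left 2)
    obtain ⟨w, hw⟩ := htu
    rw [← hw, χ₄_sq_of_unit w, mul_one]
  rw [← hχ]
  push_cast
  ring

/-- **Transform of the smoothed Eisenstein–Dedekind measure at `2`:
`L(Sm_5^5 E_{T,κ}) = (∑_{t∈T} κ_t χ₋₄(t) (1+T)^{−f_t}) · G(T^ι)·G(T)`**, where `t ≡ η_t γ^{f_t}` are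
Teichmüller–exponent data for the (odd) levels `t ∈ T` (`exists_teichmuller_exponent_natCast`) —
Stevens' factorisation of the `p`-adic `L`-function of a weight-2 Eisenstein series into two
Kubota–Leopoldt factors and the Euler-type level factor, at `p = 2`, for the SMOOTHED measure
(`distributionTransform_finset_sum_smul` + `distributionTransform_codilate` + `distributionTransform_klTwoConv`).
[cite: Stevens1982, §5.4 (PDF p. 74, L_p(E,χ,s) = ε₁(Δ)χ̄(N₁)⟨N₁⟩^{1−s}·L_p(ε̄₁χω,1−s)·L_p(ε₂χ̄ω,s−1)) and Prop. 5.4.1]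
[cite: LangCyclotomic1990, Ch. 4 §2 Meas 1 (PDF p. 81) and Ch. 12 §1 (PDF p. 187)] -/
theorem distributionTransform_smoothedEisensteinDedekindTwo (T : Finset ℕ) (κ : ℕ → ℚ)
    {η : ℕ → rootsOfUnity (torsionOrder 2) ℤ_[2]} {f : ℕ → ℤ_[2]}
    (hcf : ∀ t ∈ T, ∀ n : ℕ, PadicInt.toZModPow (n + cyclotomicExponent 2) ((η t : ℤ_[2]ˣ) : ℤ_[2]) *
        (cyclotomicGenerator 2 : ZMod (2 ^ (n + cyclotomicExponent 2))) ^ (PadicInt.toZModPow n (f t)).val =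
        (t : ZMod (2 ^ (n + cyclotomicExponent 2))))
    (hT : ∀ t ∈ T, Odd t) :
    distributionTransform (smoothedEisensteinDedekindTwo T κ) =
      (∑ t ∈ T, PowerSeries.C ((κ t : ℚ_[2]) * ((chiMinusFour 2 t : ℤ_[2]) : ℚ_[2])) *
          PowerSeries.binomialSeries ℚ_[2] (-(f t))) *
        (klTwoNumeratorInv * klTwoNumerator) := by
  rw [smoothedEisensteinDedekindTwo, distributionTransform_finset_sum_smul _ _ _
    (fun t ht ↦ codilate_distribution (two_coprime_of_odd (hT t ht)) klTwoConv_distribution)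
    (fun t _ ↦ ⟨1, norm_codilate_le t norm_klTwoConv_le_one⟩), Finset.sum_mul]
  refine Finset.sum_congr rfl fun t ht ↦ ?_
  rw [distributionTransform_codilate (hcf t ht) klTwoConv_distribution norm_klTwoConv_le_one,
    distributionTransform_klTwoConv, mul_assoc]

end EisensteinDedekindTwo

/-! ## §4 Evenness: `χ₋₄E₁`, `(χ₋₄E₁)ˇ ⋆ χ₋₄E₁`, `E_{T,κ}` and `Sm_5^5 E_{T,κ}` are even
(`x ↦ −x` on `ℤ₂^×`; needed to pass between a measure and its `η = +1` half at `p = 2`) -/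

section Even

/-- The summand `χ₋₄(b)E_1^{(4·2ⁿ)}(b)` of `klTwoDistribution` is an even function of `b ∈ ℤ/4·2ⁿ`
(odd × odd; at `b = 0` trivially). [cite: LangCyclotomic1990, Ch. 2 §2 (B_1 odd, PDF p. 39) and Ch. 4 §3 (χE_1, PDF p. 84)] -/
private theorem klTwoDistribution_summand_neg (n : ℕ) (b : ZMod (4 * 2 ^ n)) :
    ((chiMinusFour 2 (-b).val : ℤ_[2]) : ℚ_[2]) *
        ((bernoulliDist 1 (4 * 2 ^ n) (-b) / ((1 : ℕ) : ℚ) : ℚ) : ℚ_[2]) =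
      ((chiMinusFour 2 b.val : ℤ_[2]) : ℚ_[2]) *
        ((bernoulliDist 1 (4 * 2 ^ n) b / ((1 : ℕ) : ℚ) : ℚ) : ℚ_[2]) := by
  haveI : NeZero (4 * 2 ^ n) := ⟨by positivity⟩
  rcases eq_or_ne b 0 with rfl | hb
  · rw [neg_zero]
  have hχ : chiMinusFour 2 (-b).val = -chiMinusFour 2 b.val := by
    rw [ZMod.neg_val, if_neg hb]
    exact chiMinusFour_sub_of_four_dvd 2 (dvd_mul_right 4 _) (ZMod.val_lt b).le
  rw [hχ, bernoulliDist_one_neg hb]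
  push_cast
  ring

/-- **`χ₋₄E₁` is even**: `klTwoDistribution n (−a) = klTwoDistribution n a`.
[cite: LangCyclotomic1990, Ch. 2 §2 (PDF p. 39) and Ch. 4 §3 (PDF p. 84)] -/
theorem klTwoDistribution_neg (n : ℕ) (a : ZMod (2 ^ n)) :
    klTwoDistribution n (-a) = klTwoDistribution n a := by
  unfold klTwoDistribution bernoulliDistribution
  rw [Finset.sum_filter, Finset.sum_filter]
  conv_lhs => rw [← Equiv.sum_comp (Equiv.neg (ZMod (4 * 2 ^ n)))]
  refine Finset.sum_congr rfl fun b _ ↦ ?_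
  simp only [Equiv.neg_apply, map_neg, neg_inj]
  split_ifs
  · exact klTwoDistribution_summand_neg n b
  · rfl

/-- **`(χ₋₄E₁)ˇ ⋆ χ₋₄E₁` is even.** [cite: Stevens1982, §5.4 (PDF p. 73)] [cite: LangCyclotomic1990, Ch. 12 §1 (PDF p. 187)] -/
theorem klTwoDedekindConv_neg (n : ℕ) (a : ZMod (2 ^ n)) :
    klTwoDedekindConv n (-a) = klTwoDedekindConv n a := by
  unfold klTwoDedekindConv
  exact unitsConv_neg klTwoDistribution_neg n a

/-- **`E_{T,κ}` is even.** [cite: Stevens1982, §5.4 (PDF p. 73)] -/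
theorem eisensteinDedekindTwo_neg (T : Finset ℕ) (κ : ℕ → ℚ) (n : ℕ) (a : ZMod (2 ^ n)) :
    eisensteinDedekindTwo T κ n (-a) = eisensteinDedekindTwo T κ n a := by
  simp only [eisensteinDedekindTwo, Finset.sum_apply, Pi.smul_apply, smul_eq_mul]
  exact Finset.sum_congr rfl fun t _ ↦ by rw [codilate_neg t klTwoDedekindConv_neg]

/-- **`Sm_5^5 E_{T,κ}` is even** (so its Mazur–Tate Riemann sums are twice those of its `η = +1` half).
[cite: Stevens1982, §5.4 Prop. 5.4.1 (PDF p. 73)] -/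
theorem smoothedEisensteinDedekindTwo_neg (T : Finset ℕ) (κ : ℕ → ℚ) (n : ℕ) (a : ZMod (2 ^ n)) :
    smoothedEisensteinDedekindTwo T κ n (-a) = smoothedEisensteinDedekindTwo T κ n a := by
  simp only [smoothedEisensteinDedekindTwo, Finset.sum_apply, Pi.smul_apply, smul_eq_mul]
  exact Finset.sum_congr rfl fun t _ ↦ by rw [codilate_neg t klTwoConv_neg]

end Even

end Literature.NumberTheory.EllipticCurves

end
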